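import Mathlib
import Literature.Probability.Percolation.ProdBernoulliRusso
import Literature.Probability.LatticeModels.TriangularLatticeProofs
import Summits.CriticalPhenomena.CardyFormulaZ2.Theorems.CardyMagicRigidityHexSegmentDefs
import HarnessLib

/-!
# Stub `stub_flatOfSymmetry` (S6) of line `Sketch`, crux `LoopLimitZ2EqT` (stmt-CriticalPhenomena-4833)

Uniform derivative bound ⇒ segment flatness. The research stub S5 (`UniformAttachmentSymmetry`)
bounds the `t`-derivative (within `[0,1]`) of the crude crossing probability
`t ↦ segCrossℝ t R δ` of a conformal rectangle `R` by `ε`, uniformly in `t ∈ [0,1]`, once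
`0 < δ < δ₀(ε, R)`. This file integrates it (mean value inequality on the convex set `[0,1]`):
`|segCross t R δ - segCross 0 R δ| ≤ ε · |t| ≤ ε`, whence `HexSegmentFlat`.

The one real step is the differentiability of `t ↦ segCrossℝ t R δ` on `[0,1]` (so that
`derivWithin` is an honest derivative and the mean value inequality applies). Since the carrier of
`R` is bounded, the set `V` of lattice points `y` with `δ · triEmbed y ∈ R.carrier` is finite
(`triMeshVertices_finite_holds`); the crossing event `embDomainCrossing triEmbed R.carrier δ _ _`
only reads the edges `s(a, b)` with `a, b ∈ V` (it is a reachability statement in the open graph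
induced on `V`), and the state of such an edge under `cfg` only reads the coins of the cells `a`,
`b`, `a - e₀`, `b - e₀`. Hence the coin event is determined by the finite coin set
`(V ∪ (· + e₀) ⁻¹' V) × univ`, and the cylinder formula
`RussoPath.prodBernoulli_real_eq_sum_powerset` exhibits `t ↦ segCrossℝ t R δ` on `[0,1]` as a finite
sum of finite products of the factors `t`, `1 - t` and constants: a polynomial in `t`.
No monotonicity of `cfg` is used (there is none in the type bits).
-/

noncomputable section

open MeasureTheory Set Filter Metric
open scoped Real Topology BigOperators

namespace Summit.CriticalPhenomena.CardyFormulaZ2.Cruxes.LoopLimitZ2EqT.HexSegment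

open Literature.Probability.RandomPlanarGeometry Literature.Probability.Percolation
  Literature.Probability.LatticeModels

/-! ### Locality of the crossing event -/

/-- Two bond configurations that agree on the edges with both endpoints in `V` induce the same
open graph on `V`. -/
theorem flatOfSymmetry_induce_eq {V : Set (Site 2)} {ω ω' : BondConfig (Site 2)}
    (h : ∀ a ∈ V, ∀ b ∈ V, (s(a, b) ∈ ω ↔ s(a, b) ∈ ω')) :
    (openGraph ω).induce V = (openGraph ω').induce V := by
  ext ⟨a, ha⟩ ⟨b, hb⟩
  simp only [SimpleGraph.induce_adj, openGraph_adj, h a ha b hb]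

/-- The restricted connection event `{u ↔ v in V}` only reads the edges with both endpoints in
`V`. -/
theorem flatOfSymmetry_mem_openConnIn_iff {V : Set (Site 2)} {ω ω' : BondConfig (Site 2)}
    (h : ∀ a ∈ V, ∀ b ∈ V, (s(a, b) ∈ ω ↔ s(a, b) ∈ ω')) (u v : Site 2) :
    ω ∈ openConnIn V u v ↔ ω' ∈ openConnIn V u v := by
  simp only [openConnIn, mem_setOf_eq, flatOfSymmetry_induce_eq h]

/-- The embedded crossing event of `Ω` at mesh `δ` only reads the edges with both endpoints in the
set `{y | δ · triEmbed y ∈ Ω}` of lattice points drawn inside `Ω`. -/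
theorem flatOfSymmetry_mem_embDomainCrossing_iff {Ω A B : Set ℂ} {δ : ℝ}
    {ω ω' : BondConfig (Site 2)}
    (h : ∀ a ∈ {y : Site 2 | (δ : ℂ) * triEmbed y ∈ Ω}, ∀ b ∈ {y : Site 2 | (δ : ℂ) * triEmbed y ∈ Ω},
      (s(a, b) ∈ ω ↔ s(a, b) ∈ ω')) :
    ω ∈ embDomainCrossing triEmbed Ω δ A B ↔ ω' ∈ embDomainCrossing triEmbed Ω δ A B := by
  simp only [mem_embDomainCrossing_iff, flatOfSymmetry_mem_openConnIn_iff h]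

/-- The cell `x` of an up-triangle edge `upEdge x k = s(a, b)` is one of `a`, `b`, `a - e₀`,
`b - e₀`. -/
theorem flatOfSymmetry_upEdge_eq {x a b : Site 2} {k : Fin 3} (h : upEdge x k = s(a, b)) :
    x = a ∨ x = b ∨ x + ![1, 0] = a ∨ x + ![1, 0] = b := by
  unfold upEdge at h
  split_ifs at h with h0 h1
  · rcases Sym2.eq_iff.1 h with ⟨h', -⟩ | ⟨h', -⟩
    · exact Or.inl h'
    · exact Or.inr (Or.inl h')
  · rcases Sym2.eq_iff.1 h with ⟨h', -⟩ | ⟨h', -⟩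
    · exact Or.inl h'
    · exact Or.inr (Or.inl h')
  · rcases Sym2.eq_iff.1 h with ⟨h', -⟩ | ⟨h', -⟩
    · exact Or.inr (Or.inr (Or.inl h'))
    · exact Or.inr (Or.inr (Or.inr h'))

/-- The state under `cfg` of an edge with both endpoints in `V` only reads the coins of the cells
in `V ∪ (· + e₀) ⁻¹' V`. -/
theorem flatOfSymmetry_mem_cfg_iff {V : Set (Site 2)} {S S' : Set Coin}
    (hS : ∀ x ∈ V ∪ (fun y : Site 2 ↦ y + ![1, 0]) ⁻¹' V, ∀ c : Option (Option (Fin 3)),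
      ((x, c) ∈ S ↔ (x, c) ∈ S'))
    {a b : Site 2} (ha : a ∈ V) (hb : b ∈ V) :
    s(a, b) ∈ cfg S ↔ s(a, b) ∈ cfg S' := by
  simp only [cfg, mem_setOf_eq]
  refine exists_congr fun x ↦ exists_congr fun k ↦ and_congr_right fun hk ↦ ?_
  have hx : x ∈ V ∪ (fun y : Site 2 ↦ y + ![1, 0]) ⁻¹' V := by
    rcases flatOfSymmetry_upEdge_eq hk.symm with rfl | rfl | rfl | rfl
    · exact mem_union_left _ ha
    · exact mem_union_left _ hb
    · exact mem_union_right _ ha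
    · exact mem_union_right _ hb
  simp only [hS x hx]

/-- **Finite determination.** For `δ > 0` the coin event "`cfg S` crosses the conformal rectangle
`R` at mesh `δ`" is determined by finitely many coins (the carrier of `R` is bounded). -/
theorem flatOfSymmetry_determinedBy (R : ConformalRectangle) {δ : ℝ} (hδ : 0 < δ) :
    ∃ K : Finset Coin, DeterminedBy
      {S : Set Coin | cfg S ∈ embDomainCrossing triEmbed R.carrier δ (R.arc 0) (R.arc 2)}
      (↑K : Set Coin) := by
  set V : Set (Site 2) := {y | (δ : ℂ) * triEmbed y ∈ R.carrier} with hV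
  have hVfin : V.Finite := triMeshVertices_finite_holds R.isBounded hδ
  have hKC : (V ∪ (fun y : Site 2 ↦ y + ![1, 0]) ⁻¹' V).Finite :=
    hVfin.union (hVfin.preimage (add_left_injective _).injOn)
  have hK : ((V ∪ (fun y : Site 2 ↦ y + ![1, 0]) ⁻¹' V) ×ˢ
      (univ : Set (Option (Option (Fin 3))))).Finite :=
    hKC.prod finite_univ
  refine ⟨hK.toFinset, ?_⟩
  rw [Finite.coe_toFinset, determinedBy_iff]
  intro S S' hSS'
  refine flatOfSymmetry_mem_embDomainCrossing_iff fun a ha b hb ↦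
    flatOfSymmetry_mem_cfg_iff (fun x hx c ↦ ?_) ha hb
  have hxc : (x, c) ∈ (V ∪ (fun y : Site 2 ↦ y + ![1, 0]) ⁻¹' V) ×ˢ
      (univ : Set (Option (Option (Fin 3)))) := ⟨hx, mem_univ _⟩
  exact ⟨fun h' ↦ ((Set.ext_iff.1 hSS' (x, c)).1 ⟨h', hxc⟩).1,
    fun h' ↦ ((Set.ext_iff.1 hSS' (x, c)).2 ⟨h', hxc⟩).1⟩

/-! ### Polynomiality in `t` -/

/-- Each coin density `t ↦ prm t i` (type bit `t`, fair coin `1/2`, bond coin `p_c(𝕋̃)`), read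
through `Set.projIcc`, is differentiable on `[0,1]`. -/
theorem flatOfSymmetry_differentiableOn_prm (i : Coin) :
    DifferentiableOn ℝ (fun t' : ℝ ↦ ((prm (Set.projIcc (0 : ℝ) 1 zero_le_one t') i : ℝ)))
      (Icc (0 : ℝ) 1) := by
  obtain ⟨x, c⟩ := i
  rcases c with _ | _ | k
  · refine differentiableOn_id.congr fun t' ht' ↦ ?_
    simp [prm, Set.projIcc_of_mem zero_le_one ht']
  · exact (differentiableOn_const ((half : unitInterval) : ℝ)).congr fun t' _ ↦ rfl
  · exact (differentiableOn_const ((criticalWeightI (Real.pi / 6) : unitInterval) : ℝ)).congr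
      fun t' _ ↦ rfl

/-- **Differentiability along the segment.** For `δ > 0` the crude crossing probability
`t ↦ segCrossℝ t R δ` is differentiable on `[0,1]`: by finite determination and the cylinder
formula it is a finite sum of finite products of the factors `t`, `1 - t` and constants. -/
theorem flatOfSymmetry_differentiableOn (R : ConformalRectangle) {δ : ℝ} (hδ : 0 < δ) :
    DifferentiableOn ℝ (fun t' : ℝ ↦ segCrossℝ t' R δ) (Icc (0 : ℝ) 1) := by
  classical
  obtain ⟨K, hK⟩ := flatOfSymmetry_determinedBy R hδ
  have h := fun t' : ℝ ↦
    RussoPath.prodBernoulli_real_eq_sum_powerset hK (prm (Set.projIcc (0 : ℝ) 1 zero_le_one t'))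
  simp only [segCrossℝ, segCross, h]
  refine DifferentiableOn.fun_sum fun T _ ↦ ?_
  split_ifs
  · refine DifferentiableOn.fun_finsetProd fun i _ ↦ ?_
    split_ifs
    · exact flatOfSymmetry_differentiableOn_prm i
    · exact (flatOfSymmetry_differentiableOn_prm i).const_sub 1
  · exact differentiableOn_const 0

/-! ### Integration: the stub -/

/-- `segCrossℝ` restricted to `[0,1]` is `segCross`. -/
theorem flatOfSymmetry_segCrossℝ_coe (s : unitInterval) (R : ConformalRectangle) (δ : ℝ) :
    segCrossℝ (s : ℝ) R δ = segCross s R δ := by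
  simp only [segCrossℝ, Set.projIcc_val]

/-- **S6 `stub_flatOfSymmetry`: uniform derivative bound ⇒ segment flatness.** If the
`t`-derivative of every crude crossing probability along the segment is `o(1)` as `δ → 0⁺`
uniformly in `t ∈ [0,1]` (`UniformAttachmentSymmetry`), then every crude crossing probability is
asymptotically independent of `t` (`HexSegmentFlat`): mean value inequality on `[0,1]` for the
polynomial `t ↦ segCrossℝ t R δ`. -/
theorem stub_flatOfSymmetry : UniformAttachmentSymmetry → HexSegmentFlat := by
  intro h t R
  rw [Metric.tendsto_nhdsWithin_nhds]
  intro ε hε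
  obtain ⟨δ₀, hδ₀, hδ⟩ := h R (ε / 2) (half_pos hε)
  refine ⟨δ₀, hδ₀, ?_⟩
  intro δ hδpos hδlt
  rw [mem_Ioi] at hδpos
  rw [Real.dist_eq, sub_zero] at hδlt
  have hδmem : δ ∈ Ioo 0 δ₀ := ⟨hδpos, (abs_lt.1 hδlt).2⟩
  have hbound : ∀ x ∈ Icc (0 : ℝ) 1,
      ‖derivWithin (fun t' : ℝ ↦ segCrossℝ t' R δ) (Icc 0 1) x‖ ≤ ε / 2 :=
    fun x hx ↦ (Real.norm_eq_abs _).le.trans (hδ δ hδmem x hx).le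
  have hmvt := (convex_Icc (0 : ℝ) 1).norm_image_sub_le_of_norm_derivWithin_le
    (flatOfSymmetry_differentiableOn R hδpos) hbound (0 : unitInterval).2 t.2
  rw [flatOfSymmetry_segCrossℝ_coe, flatOfSymmetry_segCrossℝ_coe] at hmvt
  have ht1 : ‖(t : ℝ) - ((0 : unitInterval) : ℝ)‖ ≤ 1 := by
    rw [Real.norm_eq_abs, Set.Icc.coe_zero, sub_zero, abs_of_nonneg t.2.1]
    exact t.2.2
  calc dist (segCross t R δ - segCross 0 R δ) 0
      = ‖segCross t R δ - segCross 0 R δ‖ := by rw [Real.dist_eq, sub_zero, Real.norm_eq_abs]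
    _ ≤ ε / 2 * ‖(t : ℝ) - ((0 : unitInterval) : ℝ)‖ := hmvt
    _ ≤ ε / 2 * 1 := by gcongr
    _ < ε := by linarith

end Summit.CriticalPhenomena.CardyFormulaZ2.Cruxes.LoopLimitZ2EqT.HexSegment

end
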